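import Summits.BirchSwinnertonDyer.Rank1Residual.Additive.KatoDescentGlobalKummerLattice
import Summits.BirchSwinnertonDyer.Rank1Residual.Additive.KatoDescentLocPKummerTower
import Summits.BirchSwinnertonDyer.Rank1Residual.X10.ResidualSelmerCompanions
import Summits.BirchSwinnertonDyer.Rank1Residual.GaloisImage.SelmerLocalKerUnramifiedOfKummerCondition
import Literature.NumberTheory.EllipticCurves.Kato2004.LocPKernelRankOnePlumbing
import Literature.NumberTheory.EllipticCurves.HeegnerModuleIndex
import Literature.NumberTheory.GaloisRepresentations.IntegralGaloisActionProofs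
import HarnessLib

set_option autoImplicit false

/-!
# (R1-d), TOWARDS THE COMPACT SIDE, II: the BRIDGE between `p^j • κ_∞(P) ∈ H¹(ℤ[1/p], T_pW)` and the finite-level
# condition «`loc_v (p^j • κ_{p^k}(P))` unramified at the bad `v ≠ p`», in the LEVEL DIALECT `((p^k : ℕ) : ℤ)` of Parts 22–28
# (seat `bsd-cm-prr-ty1` g11, cell `bsd-cm`; theorems only: no definition, no named fact, no instance, no `sorry`)

Part 29 of the seat's kernel cut of stub 3 `stub_rankOneCountReadingKato` of the Kato–Perrin-Riou skeletons v4 (cruxes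
stmt-BirchSwinnertonDyer-19945 / -19223; = cell bsd-potss's held input 27322).  Part 28 reduced the second factor of
(R1-d) to `[M_k : M_k ⊓ H¹_{𝓚⊓ur@Σ}(K, E[p^k])]`, `M_k = ι_k⁻¹ κ_k(E(K))`; Part 21 (`KatoDescentGlobalKummerLattice`) computed
the compact side `H¹(ℤ[1/p], T_pW) = ℤ_p ∙ p^a κ_∞(P)` with `p^j • κ_∞(P)` integral iff `a ≤ j`.  THIS FILE carries
integrality of `p^j • κ_∞(P)` (`x` with `ofTop(red_{p^k} x) = κ_{(p:ℤ)^k}(P)`, the dialect of `Kato2004.reduceH1Pk`) to and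
from the local unramified condition on `p^j • κ_{((p^k:ℕ):ℤ)}(P)` (the dialect of X11b's `primaryInclusion` used in Parts
22–28), over `ℚ`:

* §1 (pure algebra) `index_eq_pow_of_pow_mem`, **`relIndex_zmultiples_eq_pow`** — for a subgroup `U` and an element `y` with
  `p^k • y ∈ U`: `[ℤy : ℤy ⊓ U] = p^b` for the least `b` with `p^b • y ∈ U` (subgroups of `ℤ`, `Int.index_zmultiples`).
* §2 (dialects, any field) `map_torsionInclusion_self`, `map_torsionInclusion_mem_unramifiedKer_iff_of_eq`,
  `map_torsionInclusion_kummerMapTorsion_of_eq` — along `torsionInclusion : E[d] ↪ E[N]` for `d = N` (e.g.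
  `(p:ℤ)^k = ((p^k:ℕ):ℤ)`) Kummer classes and «principal on `I_𝔓`» correspond (`subst`).
* §3 (over `ℚ`) `reduceH1Pk_eq_zero_of_le` — `red_{p^{k'}} z = 0 ⟹ red_{p^k} z = 0` for `k ≤ k'` on any `H¹(U, T_pW)`
  (`mapH1AddHom_reduceH1Pk_succ`); `ofTopSubgroup_reduceH1Pk_nsmul_eq`;
  **`localization_kummerMapTorsion_nsmul_mem_unramifiedSubgroup_of_mem_integralH1`** —
  `p^j • x ∈ H¹(ℤ[1/p], T_pW) ⟹ loc_v κ_{p^k}(p^j • P) ∈ H¹_ur(ℚ_v, E[p^k])` at every `v ≠ p`, every `k`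
  (`reduceH1Pk_mem_integralH1`, `ofTopSubgroup_mem_unramifiedKer_of_mem_integralH1`, §2, X10
  `localization_mem_unramifiedSubgroup_iff_mem_unramifiedKer`); **`pow_smul_mem_integralH1_of_forall_localization_mem`** —
  conversely, if `loc_v κ_{p^k}(p^j • P)` is unramified at every `v ∈ Σ` for all `k ≥ k₁`, `Σ ⊇` the bad `v ≠ p`, then
  `p^j • x ∈ H¹(ℤ[1/p], T_pW)` (good `v`: Part 13's `resLe_inf_inertia_eq_zero_of_forall_eq`; bad `v`: separatedness
  `eq_zero_of_forall_reduceH1Pk_eq_zero` on `⊤ ⊓ I_𝔓` as in Part 15, all primes `𝔓 ∣ v` by `Γ_ℚ`-transitivity and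
  `unramifiedKer_smul`, the small levels by `reduceH1Pk_eq_zero_of_le`).

HONEST LABEL: theorems only; no stub or item is closed; nothing is registered; nothing is asserted on 19945 / 19223;
Kato's Main Conjecture and Perrin-Riou's conjecture are not touched; BSD is not proved for any curve.

References: [Kato2004Asterisque] §8.2 (pp. 180–181), Lemma 8.5, §13.8 (p. 228), §14.1 (p. 235); [SilvermanAEC2009] VIII.§2,
X.4.1.1; [MilneADT2006] Ch. I Prop. 3.8; [NeukirchANT1999] I §9 (9.1); [Rubin2000] App. B Prop. B.2.3.
-/

noncomputable section

open scoped Classical NumberField ContRepresentation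

open WeierstrassCurve Field IsDedekindDomain NumberField CategoryTheory Literature.NumberTheory.EllipticCurves
  Literature.NumberTheory.EllipticCurves.Kato2004 Literature.NumberTheory.GaloisRepresentations
  Literature.NumberTheory.EllipticCurves.Kato2004.EulerSystemValues
  Literature.NumberTheory.GaloisRepresentations.DiscreteGaloisModule
open WeierstrassCurve (geomPoints geomTorsion galH1Torsion kummerMapTorsion)
open Summit.BirchSwinnertonDyer.Rank1Residual.Additive.GlobalKummer
open Summit.BirchSwinnertonDyer.Rank1Residual.GaloisImage.InertiaDivisible

universe u

namespace Summit.BirchSwinnertonDyer.Rank1Residual.Additive.KummerUnramified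

/-! ## §1 The index of a subgroup in a cyclic `p`-power-torsion group -/

section Algebra

/-- A subgroup `H ≤ ℤ` containing some `p^k`, with `b` the least exponent such that `p^b ∈ H`, has index `p^b`
(`H = dℤ`, `d ∣ p^k`). [folklore] -/
theorem index_eq_pow_of_pow_mem {p : ℕ} (hp : p.Prime) (H : AddSubgroup ℤ) {k : ℕ} (hk : ((p ^ k : ℕ) : ℤ) ∈ H)
    (b : ℕ) (hb : ((p ^ b : ℕ) : ℤ) ∈ H) (hmin : ∀ j, ((p ^ j : ℕ) : ℤ) ∈ H → b ≤ j) :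
    H.index = p ^ b := by
  obtain ⟨d, hd⟩ := Int.subgroup_cyclic H
  rw [← AddSubgroup.zmultiples_eq_closure] at hd
  subst hd
  rw [Int.index_zmultiples]
  have hdk : d.natAbs ∣ p ^ k := by
    have h := Int.natAbs_dvd_natAbs.2 (Int.mem_zmultiples_iff.1 hk)
    rwa [Int.natAbs_natCast] at h
  obtain ⟨j, -, hj⟩ := (Nat.dvd_prime_pow hp).1 hdk
  rw [hj]
  have hbj : b ≤ j := hmin j (Int.mem_zmultiples_iff.2 (Int.natAbs_dvd_natAbs.1 (by rw [Int.natAbs_natCast, hj])))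
  have hjb : j ≤ b := by
    have h := Int.natAbs_dvd_natAbs.2 (Int.mem_zmultiples_iff.1 hb)
    rw [Int.natAbs_natCast, hj, Nat.pow_dvd_pow_iff_le_right hp.one_lt] at h
    exact h
  rw [le_antisymm hjb hbj]

/-- **`[ℤy : ℤy ⊓ U] = p^b`** for the least `b` with `p^b • y ∈ U`, when some `p^k • y ∈ U` (pull back along `ℤ ↠ ℤy`,
`AddSubgroup.index_comap_of_surjective`). [folklore] -/
theorem relIndex_zmultiples_eq_pow {G : Type*} [AddCommGroup G] (U : AddSubgroup G) (y : G) {p : ℕ} (hp : p.Prime)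
    {k : ℕ} (hk : p ^ k • y ∈ U) (b : ℕ) (hb : p ^ b • y ∈ U) (hmin : ∀ j, p ^ j • y ∈ U → b ≤ j) :
    U.relIndex (AddSubgroup.zmultiples y) = p ^ b := by
  set f : ℤ →+ AddSubgroup.zmultiples y := zmultiplesHom (AddSubgroup.zmultiples y) ⟨y, AddSubgroup.mem_zmultiples y⟩
    with hf
  have hfn : ∀ n : ℤ, ((f n : AddSubgroup.zmultiples y) : G) = n • y := fun n => by
    rw [hf, zmultiplesHom_apply, AddSubgroupClass.coe_zsmul]
  have hfs : Function.Surjective f := by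
    rintro ⟨z, hz⟩
    obtain ⟨n, rfl⟩ := AddSubgroup.mem_zmultiples_iff.1 hz
    exact ⟨n, Subtype.ext (hfn n)⟩
  have hmem : ∀ j : ℕ, ((p ^ j : ℕ) : ℤ) ∈ (U.addSubgroupOf (AddSubgroup.zmultiples y)).comap f ↔ p ^ j • y ∈ U := by
    intro j
    rw [AddSubgroup.mem_comap, AddSubgroup.mem_addSubgroupOf, hfn, natCast_zsmul]
  rw [AddSubgroup.relIndex, ← AddSubgroup.index_comap_of_surjective _ hfs]
  exact index_eq_pow_of_pow_mem hp _ ((hmem k).2 hk) b ((hmem b).2 hb) fun j hj => hmin j ((hmem j).1 hj)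

end Algebra

/-! ## §2 The two level dialects `(p : ℤ)^k` and `((p^k : ℕ) : ℤ)`: transport along `torsionInclusion` for EQUAL levels -/

section Dialect

variable {K : Type u} [Field K] (W : WeierstrassCurve K)

/-- `H¹(torsionInclusion (d ∣ d)) = id` on `H¹(K, E[d])` (the inclusion `E[d] ↪ E[d]` is the identity on points). [folklore] -/
theorem map_torsionInclusion_self {d : ℤ} (h : d ∣ d) (c : galH1Torsion W d) :
    galoisCohomology.map (W.torsionInclusion h) 1 c = c := by
  obtain ⟨φ, rfl⟩ := oneCocycleClass_surjective _ c
  erw [galoisCohomology.map_one_oneCocycleClass]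
  rfl

/-- **Kummer maps across equal levels written differently** (`d = N`, e.g. `(p:ℤ)^k = ((p^k:ℕ):ℤ)`):
`H¹(torsionInclusion)(κ_d(P)) = κ_N(P)`. [cite: SilvermanAEC2009, VIII.§2 (p. 191)] -/
theorem map_torsionInclusion_kummerMapTorsion_of_eq [W.IsElliptic] {d N : ℤ} (hdN : d = N) (h : d ∣ N)
    (hdiv : ∀ P : geomPoints W, ∃ Q : geomPoints W, d • Q = P)
    (hdiv' : ∀ P : geomPoints W, ∃ Q : geomPoints W, N • Q = P) (P : W.toAffine.Point) :
    galoisCohomology.map (W.torsionInclusion h) 1 (kummerMapTorsion W d hdiv P) = kummerMapTorsion W N hdiv' P := by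
  subst hdN
  rw [map_torsionInclusion_self]

/-- **«Principal on `I_𝔓`» across equal levels written differently** (`d = N`). [cite: SilvermanAEC2009, Remark X.4.1.1] -/
theorem map_torsionInclusion_mem_unramifiedKer_iff_of_eq {d N : ℤ} (hdN : d = N) (h : d ∣ N)
    (𝔓 : Ideal (absIntegers (𝓞 K) K)) (c : galH1Torsion W d) :
    galoisCohomology.map (W.torsionInclusion h) 1 c ∈ unramifiedKer (geomTorsion W N) 𝔓 ↔
      c ∈ unramifiedKer (geomTorsion W d) 𝔓 := by
  subst hdN
  rw [map_torsionInclusion_self]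
  exact Iff.rfl

end Dialect

/-! ## §3 Over `ℚ`: integrality of `p^j • κ_∞(P)` versus «`loc_v (p^j • κ_{p^k}(P))` unramified» at the places `v ≠ p` -/

section Compact

variable (W : WeierstrassCurve ℚ) [W.IsElliptic] (p : ℕ) [hp : Fact p.Prime]

/-- Divisibility of `E(ℚ̄)` by `((p^k : ℕ) : ℤ)` (for the level-`p^k` Kummer map of the `ℕ`-dialect). [folklore] -/
theorem zsmul_natCast_pow_surjective (k : ℕ) (P : geomPoints W) : ∃ Q : geomPoints W, ((p ^ k : ℕ) : ℤ) • Q = P :=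
  W.zsmul_geomPoints_surjective_holds (by exact_mod_cast pow_ne_zero k hp.out.ne_zero) P

variable [ContinuousSMul ℤ_[p] (W.tateModule p)]

/-- **`red_{p^{k'}} z = 0 ⟹ red_{p^k} z = 0` for `k ≤ k'`** on `H¹(U, T_pW)`, any `U ≤ Γ_ℚ` (the reductions are compatible
under `p • : E[p^{k+1}] → E[p^k]`, `mapH1AddHom_reduceH1Pk_succ`). [cite: Kato2004Asterisque, §13.8 (p. 228)] -/
theorem reduceH1Pk_eq_zero_of_le (U : Subgroup (absoluteGaloisGroup ℚ)) (z : H1 (tateRep W p) U) {k k' : ℕ}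
    (hkk' : k ≤ k') (h : reduceH1Pk W p k' U z = 0) : reduceH1Pk W p k U z = 0 := by
  obtain ⟨d, rfl⟩ := Nat.exists_eq_add_of_le hkk'
  have key : ∀ d : ℕ, reduceH1Pk W p (k + d) U z = 0 → reduceH1Pk W p k U z = 0 := by
    intro d
    induction d with
    | zero => exact id
    | succ d ih =>
      intro hd
      have hd' : reduceH1Pk W p (k + d + 1) U z = 0 := hd
      apply ih
      rw [← mapH1AddHom_reduceH1Pk_succ W p (k + d) U (W.geomTorsionReduce p (k + d))
        (W.coe_geomTorsionReduce p (k + d)) z, hd', map_zero]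
  exact key d h

/-- `ofTop(red_{p^i}(p^j • x)) = κ_{p^i}(p^j • P)` when `ofTop(red_{p^i} x) = κ_{p^i}(P)` (additivity of `κ` over `ℚ`,
`kummerMapTorsion_nsmul'`). [cite: SilvermanAEC2009, VIII.§2] -/
theorem ofTopSubgroup_reduceH1Pk_nsmul_eq {P : W.toAffine.Point} {x : H1 (tateRep W p) ⊤}
    (hx : ∀ j : ℕ,
      (ofTopSubgroup (W.torsionGaloisModule ((p : ℤ) ^ j)).toTopRep 1).hom (reduceH1Pk W p j ⊤ x) =
        kummerMapTorsion W ((p : ℤ) ^ j) (zsmul_pow_surjective W p j) P)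
    (j i : ℕ) :
    (ofTopSubgroup (W.torsionGaloisModule ((p : ℤ) ^ i)).toTopRep 1).hom (reduceH1Pk W p i ⊤ (p ^ j • x)) =
      kummerMapTorsion W ((p : ℤ) ^ i) (zsmul_pow_surjective W p i) (p ^ j • P) := by
  rw [map_nsmul, map_nsmul, hx i, kummerMapTorsion_nsmul']
  rfl

/-- **`p^j • κ_∞(P) ∈ H¹(ℤ[1/p], T_pW) ⟹ loc_v κ_{p^k}(p^j • P) ∈ H¹_ur(ℚ_v, E[p^k])` at every `v ≠ p`, every `k`**
(ℕ-dialect `((p^k:ℕ):ℤ)` on the finite side): integrality survives `red_{p^k}` (`reduceH1Pk_mem_integralH1`), an integral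
finite-level class is principal on `I_𝔓` (`ofTopSubgroup_mem_unramifiedKer_of_mem_integralH1`), §2 moves it to the
ℕ-dialect, and X10's bridge reads it locally. [cite: Kato2004Asterisque, §8.2 (p. 180) and §13.8 (p. 228)]
[cite: MilneADT2006, Ch. I Prop. 3.8] -/
theorem localization_kummerMapTorsion_nsmul_mem_unramifiedSubgroup_of_mem_integralH1 {P : W.toAffine.Point}
    {x : H1 (tateRep W p) ⊤}
    (hx : ∀ j : ℕ,
      (ofTopSubgroup (W.torsionGaloisModule ((p : ℤ) ^ j)).toTopRep 1).hom (reduceH1Pk W p j ⊤ x) =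
        kummerMapTorsion W ((p : ℤ) ^ j) (zsmul_pow_surjective W p j) P)
    {j : ℕ} (hj : p ^ j • x ∈ integralH1 (tateRep W p) p ⊤) (k : ℕ)
    {v : HeightOneSpectrum (𝓞 ℚ)} (hv : ((Rat.HeightOneSpectrum.primesEquiv v : Nat.Primes) : ℕ) ≠ p) :
    galoisCohomology.localization (W.torsionGaloisModule ((p ^ k : ℕ) : ℤ)) (Sum.inr v) 1
        (kummerMapTorsion W ((p ^ k : ℕ) : ℤ) (zsmul_natCast_pow_surjective W p k) (p ^ j • P)) ∈
      unramifiedSubgroup (GaloisRep.toLocal v (W.torsionGaloisModule ((p ^ k : ℕ) : ℤ))) 1 := by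
  -- `ℤ`-dialect: `ofTop(red_k(p^j x)) = κ_{(p:ℤ)^k}(p^j • P)` is principal on `I_{𝔓_v}`
  have h2 : kummerMapTorsion W ((p : ℤ) ^ k) (zsmul_pow_surjective W p k) (p ^ j • P) ∈
      unramifiedKer (geomTorsion W ((p : ℤ) ^ k)) (adicCompletionPrime ℚ v) := by
    rw [← ofTopSubgroup_reduceH1Pk_nsmul_eq W p hx j k]
    exact ofTopSubgroup_mem_unramifiedKer_of_mem_integralH1 W p ((p : ℤ) ^ k) (reduceH1Pk_mem_integralH1 W p k ⊤ hj)
      hv (adicCompletionPrime_mem_primesAbove ℚ v)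
  -- move to the `ℕ`-dialect
  have h3 : kummerMapTorsion W ((p ^ k : ℕ) : ℤ) (zsmul_natCast_pow_surjective W p k) (p ^ j • P) ∈
      unramifiedKer (geomTorsion W ((p ^ k : ℕ) : ℤ)) (adicCompletionPrime ℚ v) := by
    rw [← map_torsionInclusion_kummerMapTorsion_of_eq W (Nat.cast_pow p k).symm (LocPKummer.intPow_dvd_natCast_pow' p k)
      (zsmul_pow_surjective W p k) (zsmul_natCast_pow_surjective W p k) (p ^ j • P)]
    exact (map_torsionInclusion_mem_unramifiedKer_iff_of_eq W (Nat.cast_pow p k).symm _ _ _).2 h2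
  exact (X10.ResidualSelmerCompanions.localization_mem_unramifiedSubgroup_iff_mem_unramifiedKer W _ v _).2 h3

/-- **Conversely: unramified at every `v ∈ Σ ⊇ {bad v ≠ p}` for all large `k` ⟹ `p^j • κ_∞(P) ∈ H¹(ℤ[1/p], T_pW)`.**
At the good `v ≠ p` the class `p^j • κ_∞(P) = κ_∞(p^j • P)` is unramified outright (Part 13); at a bad `v ∈ Σ` and a prime
`𝔓 ∣ v`: `res_{⊤⊓I_𝔓}(p^j • x) = 0` by separatedness of `H¹(⊤ ⊓ I_𝔓, T_pW)` in the tower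
(`eq_zero_of_forall_reduceH1Pk_eq_zero`; levels `< k₁` from level `k₁` by `reduceH1Pk_eq_zero_of_le`), each `red_{p^k}` being the
restriction of the finite-level class `κ_{p^k}(p^j • P)`, principal on `I_𝔓` (X10's bridge at `𝔓_v`, §2, `Γ_ℚ`-transitivity on
the primes over `v` and `unramifiedKer_smul`). [cite: Kato2004Asterisque, §8.2 (pp. 180–181) and Lemma 8.5]
[cite: Rubin2000, App. B Prop. B.2.3] [cite: NeukirchANT1999, I §9 (9.1)] -/
theorem pow_smul_mem_integralH1_of_forall_localization_mem {P : W.toAffine.Point} {x : H1 (tateRep W p) ⊤}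
    (hx : ∀ j : ℕ,
      (ofTopSubgroup (W.torsionGaloisModule ((p : ℤ) ^ j)).toTopRep 1).hom (reduceH1Pk W p j ⊤ x) =
        kummerMapTorsion W ((p : ℤ) ^ j) (zsmul_pow_surjective W p j) P)
    (Q : Finset (HeightOneSpectrum (𝓞 ℚ)))
    (hQbad : ∀ v : HeightOneSpectrum (𝓞 ℚ), v ∈ W.badPlaces (𝓞 ℚ) →
      ((Rat.HeightOneSpectrum.primesEquiv v : Nat.Primes) : ℕ) ≠ p → v ∈ Q)
    {j k₁ : ℕ}
    (hur : ∀ k, k₁ ≤ k → ∀ v ∈ Q,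
      galoisCohomology.localization (W.torsionGaloisModule ((p ^ k : ℕ) : ℤ)) (Sum.inr v) 1
          (kummerMapTorsion W ((p ^ k : ℕ) : ℤ) (zsmul_natCast_pow_surjective W p k) (p ^ j • P)) ∈
        unramifiedSubgroup (GaloisRep.toLocal v (W.torsionGaloisModule ((p ^ k : ℕ) : ℤ))) 1) :
    p ^ j • x ∈ integralH1 (tateRep W p) p ⊤ := by
  have hx' := ofTopSubgroup_reduceH1Pk_nsmul_eq W p hx j
  rw [mem_integralH1_iff]
  intro v hvp 𝔓 h𝔓
  by_cases hbad : v ∈ W.badPlaces (𝓞 ℚ)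
  · have hvQ : v ∈ Q := hQbad v hbad hvp
    refine eq_zero_of_forall_reduceH1Pk_eq_zero W p _ _ fun k => ?_
    refine reduceH1Pk_eq_zero_of_le W p _ _ (le_max_left k k₁) ?_
    rw [reduceH1Pk_resLe, reduceH1Pk_eq_resSubgroup_of_ofTopSubgroup_eq W p (zsmul_pow_surjective W p) hx' (max k k₁)]
    refine resLe_inf_inertia_resSubgroup_top_eq_zero_of_mem_unramifiedKer W ((p : ℤ) ^ max k k₁) 𝔓 _ ?_
    -- `κ_{(p:ℤ)^K}(p^j • P)` is principal on `I_𝔓`, `K = max k k₁`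
    obtain ⟨g, hg⟩ := HeightOneSpectrum.exists_smul_eq_of_mem_primesAbove_holds
      (adicCompletionPrime_mem_primesAbove ℚ v) h𝔓
    rw [← hg, unramifiedKer_smul]
    have h3 := (X10.ResidualSelmerCompanions.localization_mem_unramifiedSubgroup_iff_mem_unramifiedKer W _ v _).1
      (hur (max k k₁) (le_max_right k k₁) v hvQ)
    rw [← map_torsionInclusion_kummerMapTorsion_of_eq W (Nat.cast_pow p (max k k₁)).symm
      (LocPKummer.intPow_dvd_natCast_pow' p (max k k₁)) (zsmul_pow_surjective W p (max k k₁))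
      (zsmul_natCast_pow_surjective W p (max k k₁)) (p ^ j • P)] at h3
    exact (map_torsionInclusion_mem_unramifiedKer_iff_of_eq W (Nat.cast_pow p (max k k₁)).symm _ _ _).1 h3
  · exact resLe_inf_inertia_eq_zero_of_forall_eq W p (zsmul_pow_surjective W p) hx' hbad hvp h𝔓

end Compact

end Summit.BirchSwinnertonDyer.Rank1Residual.Additive.KummerUnramified

end
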